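import Summits.QuantumFields.YangMills.Theorems.UnitScaleTiltProp7CovariantWeitzenbock
import HarnessLib

/-!
# Route `UnitScaleTilt`, crux K1 «MinimiserStabilityRegPr» (stmt-QuantumFields-19200), route-R E′ path (α′), S2 ∕ (E1-b) at the CURVED background — (R-cov) IN DUAL FORM:
# THE COVARIANT PINNED-BIHARMONIC INTERPOLATION ERROR AND ITS COVARIANT GRADIENT, PAIRED WITH A TEST MATRIX, ARE `Σ_z ⟨Δ_U w(z), Δ_Uφ(z)⟩_HS` FOR AN EXPLICIT PINNED FIELD `w`
# — so the covariant (hK₀)∕(hK) rows of P-cov1 are bounds `Σ_z‖Δ_Uw(z)‖_HS ≤ κ‖X‖_HS`, the SAME currency as the flat door ✓ `Prop7PinnedKernelL1OfRows`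

Cell `ym3-torus`, extra width seat `ym-routeR-w6` (gen 6); LOCATE `ym-routeR-w6/LOCATE-PCOV2-routeRw6g6.md` v1.1 §1 (R-cov) ∕ §4.  THEOREMS ONLY (0 `def`, 0 `sorry`);
`--supports stmt-QuantumFields-19200`, count-neutral.  YM₃ on T³ is a ladder rung (R3), not the Clay problem; nothing here claims a stub, the crux, d = 4 or the mass gap.

WHY DUAL.  The flat reduction ✓ `Prop7CentreHarmonicInterpKernel` writes `∂(φ − φ_H)(b) = Σ_z K(b,z)•Δφ(z)` with a REAL Green matrix; at a non-abelian background the pinned Green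
operator of `Δ_U²` has `End(M_N ℂ)`-valued entries.  Pairing with a test matrix `X` instead, Green's second identity for `Δ_U` (self-adjoint for the `Re Tr` pairing at a unitary
background, ✓ `B9Eq39Adjoint.sum_sum_covD_mul`) gives, for ANY pinned `w` whose covariant bi-Laplacian off the pins is the point source `δ_x·X` (resp. the covariant dipole
`δ_{x+e_μ}·R(U_μ(x))⁻¹X − δ_x·X`):  `⟨X, (φ − φ_H)(x)⟩ = Σ_z ⟨Δ_Uw(z), Δ_Uφ(z)⟩` (resp. `⟨X, D_U(φ − φ_H)(x,μ)⟩ = …`).  Existence of such `w` is the (I-site)-class row,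
uniqueness is ✓ `Prop7PinnedCovBiharmonicUniqueness`; neither is used here (the identities hold for every such `w`).

WHAT IS PROVED (ns `…Theorems.Prop7CovInterpKernelDual`; torus `Site P i`, `T = torusT P i`, unitary `U`, `Δ_Uf = divB T U (fun μ => covD T U μ f)`, `⟨X,Y⟩ = Re Tr(X^*Y)`, `hs X = Σ‖X_jk‖²`).
* §1 `re_trace_conjTranspose_mul_R` (`⟨X, R(u)Y⟩ = ⟨R(u⁻¹)X, Y⟩`, unitary `u`), `abs_re_trace_le_sqrt_mul_sqrt` (Cauchy–Schwarz for the pairing), `hs_eq_zero_iff`.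
* §2 `covLaplace_sub` (linearity), ★ `sum_re_trace_covLaplace_comm` (`Σ⟨Δ_Uf, g⟩ = Σ⟨f, Δ_Ug⟩`).
* §3 ★★ `re_trace_interp_error_eq` — ZEROTH ORDER (the (hK₀) representation): `⟨X, (φ − φ_H)(x)⟩ = Σ_z ⟨Δ_Uw(z), Δ_Uφ(z)⟩` for `w|_C = 0`, `Δ_U²w = δ_x·X` off `C`.
* §4 ★★★ `re_trace_covD_interp_error_eq` — FIRST ORDER (the (hK) representation) with the covariant dipole source.
* §5 ★★★ `hs_covD_interp_error_le` ∕ `sqrt_hs_covD_interp_error_le` — `‖D_U(φ − φ_H)(x,μ)‖_HS ≤ κ·s₁` from `sup_z‖Δ_Uφ(z)‖_HS ≤ s₁` and the displayed kernel row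
  `∀ X, ∃ w (pinned, dipole source), Σ_z‖Δ_Uw(z)‖_HS ≤ κ‖X‖_HS`; and the zeroth-order twin ★★ `sqrt_hs_interp_error_le`.
HONEST SCOPE.  Exact linear algebra + one Cauchy–Schwarz; the kernel rows (the covariant (A) programme) and the existence of the `w`'s stay displayed.

References: T. Bałaban, CMP 99 (1985) 389–434 [Balaban1985BackgroundPropagators] ((3.8) p.392); CMP 95 (1984) 17–40 [Balaban1984PropagatorsI] ((1.21) p.21);
CMP 99 (1985) 75–102 [Balaban1985RegularSpaces] ((1.14) p.78, (1.36) p.82).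
-/

set_option autoImplicit false

noncomputable section

open scoped BigOperators Matrix.Norms.L2Operator Matrix

namespace Summit.QuantumFields.YangMills.Theorems.Prop7CovInterpKernelDual

open Literature.MathematicalPhysics.QuantumFieldTheory.Balaban1983to89
open B9Eq39Adjoint (R R_def covD divB sum_sum_covD_mul)
open B9TorusCalculus (torusT)
open Summit.QuantumFields.YangMills.Theorems.Prop7CovariantCoercivity (conjTranspose_covD conjTranspose_R coe_inv_eq_star inv_mem_unitary
  re_trace_conjTranspose_mul re_trace_conjTranspose_mul_self re_trace_conjTranspose_mul_comm re_trace_mul_comm two_mul_abs_re_trace_le)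

variable {P : Params} {i : ℕ} {N : ℕ} [NeZero N]

/-! ## §1 The Hilbert–Schmidt pairing: unitary conjugation, Cauchy–Schwarz -/

omit [NeZero N] in
/-- `⟨X, R(u)Y⟩ = ⟨R(u⁻¹)X, Y⟩` for unitary `u` (`(u⁻¹Xu)^* = u⁻¹X^*u`, cyclicity of the trace). [folklore] -/
theorem re_trace_conjTranspose_mul_R {u : (Matrix (Fin N) (Fin N) ℂ)ˣ} (hu : (u : Matrix (Fin N) (Fin N) ℂ) ∈ unitary (Matrix (Fin N) (Fin N) ℂ))
    (X Y : Matrix (Fin N) (Fin N) ℂ) :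
    ((Xᴴ * R u Y).trace).re = (((R u⁻¹ X)ᴴ * Y).trace).re := by
  rw [conjTranspose_R (inv_mem_unitary hu), R_def, R_def, inv_inv]
  have h1 : ((u⁻¹ : (Matrix (Fin N) (Fin N) ℂ)ˣ) : Matrix (Fin N) (Fin N) ℂ) * Xᴴ * (u : Matrix (Fin N) (Fin N) ℂ) * Y
      = ((u⁻¹ : (Matrix (Fin N) (Fin N) ℂ)ˣ) : Matrix (Fin N) (Fin N) ℂ) * (Xᴴ * (u : Matrix (Fin N) (Fin N) ℂ) * Y) := by
    simp only [mul_assoc]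
  have h2 : Xᴴ * ((u : Matrix (Fin N) (Fin N) ℂ) * Y * ((u⁻¹ : (Matrix (Fin N) (Fin N) ℂ)ˣ) : Matrix (Fin N) (Fin N) ℂ))
      = (Xᴴ * (u : Matrix (Fin N) (Fin N) ℂ) * Y) * ((u⁻¹ : (Matrix (Fin N) (Fin N) ℂ)ˣ) : Matrix (Fin N) (Fin N) ℂ) := by
    simp only [mul_assoc]
  rw [h1, h2, Matrix.trace_mul_comm ((u⁻¹ : (Matrix (Fin N) (Fin N) ℂ)ˣ) : Matrix (Fin N) (Fin N) ℂ) (Xᴴ * (u : Matrix (Fin N) (Fin N) ℂ) * Y)]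

omit [NeZero N] in
/-- `hs X = 0 ↔ X = 0`. [folklore] -/
theorem hs_eq_zero_iff (X : Matrix (Fin N) (Fin N) ℂ) : ∑ j : Fin N, ∑ k : Fin N, ‖X j k‖ ^ 2 = 0 ↔ X = 0 := by
  constructor
  · intro h
    ext j k
    have hj := (Finset.sum_eq_zero_iff_of_nonneg fun j _ => Finset.sum_nonneg fun k _ => sq_nonneg ‖X j k‖).1 h j (Finset.mem_univ _)
    have hk := (Finset.sum_eq_zero_iff_of_nonneg fun k _ => sq_nonneg ‖X j k‖).1 hj k (Finset.mem_univ _)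
    rw [Matrix.zero_apply]
    exact norm_eq_zero.1 (pow_eq_zero_iff two_ne_zero |>.1 hk)
  · rintro rfl
    simp

omit [NeZero N] in
/-- **CAUCHY–SCHWARZ FOR THE PAIRING**: `|Re Tr(X^*Y)| ≤ √hs(X)·√hs(Y)` (from the weighted AM–GM ✓ `two_mul_abs_re_trace_le` at the optimal weight). [folklore] -/
theorem abs_re_trace_le_sqrt_mul_sqrt (X Y : Matrix (Fin N) (Fin N) ℂ) :
    |((Xᴴ * Y).trace).re| ≤ Real.sqrt (∑ j : Fin N, ∑ k : Fin N, ‖X j k‖ ^ 2) * Real.sqrt (∑ j : Fin N, ∑ k : Fin N, ‖Y j k‖ ^ 2) := by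
  set A : ℝ := ∑ j : Fin N, ∑ k : Fin N, ‖X j k‖ ^ 2 with hA
  set B : ℝ := ∑ j : Fin N, ∑ k : Fin N, ‖Y j k‖ ^ 2 with hB
  have hA0 : 0 ≤ A := Finset.sum_nonneg fun _ _ => Finset.sum_nonneg fun _ _ => sq_nonneg _
  have hB0 : 0 ≤ B := Finset.sum_nonneg fun _ _ => Finset.sum_nonneg fun _ _ => sq_nonneg _
  rcases hA0.eq_or_lt with hA1 | hA1
  · have hX : X = 0 := (hs_eq_zero_iff X).1 hA1.symm
    rw [hX, Matrix.conjTranspose_zero, zero_mul, Matrix.trace_zero, Complex.zero_re, abs_zero]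
    positivity
  rcases hB0.eq_or_lt with hB1 | hB1
  · have hY : Y = 0 := (hs_eq_zero_iff Y).1 hB1.symm
    rw [hY, mul_zero, Matrix.trace_zero, Complex.zero_re, abs_zero]
    positivity
  have hsA := Real.sqrt_pos.2 hA1
  have hsB := Real.sqrt_pos.2 hB1
  have h := two_mul_abs_re_trace_le (div_pos hsB hsA) X Y
  have e1 : Real.sqrt B / Real.sqrt A * A = Real.sqrt A * Real.sqrt B := by
    have hAA := Real.mul_self_sqrt hA0
    field_simp
    nlinarith [hAA]
  have e2 : (Real.sqrt B / Real.sqrt A)⁻¹ * B = Real.sqrt A * Real.sqrt B := by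
    have hBB := Real.mul_self_sqrt hB0
    rw [inv_div]
    field_simp
    nlinarith [hBB]
  rw [e1, e2] at h
  linarith

/-! ## §2 Linearity and self-adjointness of the covariant Laplacian for the pairing -/

section Laplace

variable {U : Fin P.d → Site P i → (Matrix (Fin N) (Fin N) ℂ)ˣ}

omit [NeZero N] in
/-- `Δ_U(f − g) = Δ_Uf − Δ_Ug` pointwise. [cite: Balaban1985BackgroundPropagators, (3.8) p.392] -/
theorem covLaplace_sub (f g : Site P i → Matrix (Fin N) (Fin N) ℂ) (x : Site P i) :
    divB (torusT P i) U (fun μ => covD (torusT P i) U μ (fun z => f z - g z)) x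
      = divB (torusT P i) U (fun μ => covD (torusT P i) U μ f) x - divB (torusT P i) U (fun μ => covD (torusT P i) U μ g) x := by
  have hD : ∀ (μ : Fin P.d) (y : Site P i), covD (torusT P i) U μ (fun z => f z - g z) y = covD (torusT P i) U μ f y - covD (torusT P i) U μ g y := by
    intro μ y; simp only [covD, B9Eq39Adjoint.R_sub]; abel
  simp only [divB, B9Eq39Adjoint.covDstar, hD, B9Eq39Adjoint.R_sub, ← Finset.sum_sub_distrib]
  refine Finset.sum_congr rfl fun μ _ => ?_
  abel

omit [NeZero N] in
/-- ★ **`Σ_x ⟨Δ_Uf(x), g(x)⟩ = Σ_x ⟨f(x), Δ_Ug(x)⟩`** — the covariant Laplacian is symmetric for the `Re Tr` pairing at a unitary background ([B9] (3.8) adjointness twice).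
[cite: Balaban1985BackgroundPropagators, (3.8) p.392] -/
theorem sum_re_trace_covLaplace_comm (hU : ∀ ν x, (U ν x : Matrix (Fin N) (Fin N) ℂ) ∈ unitary (Matrix (Fin N) (Fin N) ℂ))
    (f g : Site P i → Matrix (Fin N) (Fin N) ℂ) :
    ∑ x : Site P i, (((divB (torusT P i) U (fun μ => covD (torusT P i) U μ f) x)ᴴ * g x).trace).re
      = ∑ x : Site P i, (((f x)ᴴ * divB (torusT P i) U (fun μ => covD (torusT P i) U μ g) x).trace).re := by
  set τ := Complex.reAddGroupHom.comp (Matrix.traceAddMonoidHom (Fin N) ℂ) with hτ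
  have hτa : ∀ A : Matrix (Fin N) (Fin N) ℂ, τ A = (A.trace).re := fun A => by simp [hτ]
  -- `⟨f, Δg⟩ = ΣΣ ⟨D f, D g⟩`
  have h1 := sum_sum_covD_mul (torusT P i) U τ re_trace_mul_comm (fun z => (f z)ᴴ) (fun μ => covD (torusT P i) U μ g)
  -- `⟨g, Δf⟩ = ΣΣ ⟨D g, D f⟩`
  have h2 := sum_sum_covD_mul (torusT P i) U τ re_trace_mul_comm (fun z => (g z)ᴴ) (fun μ => covD (torusT P i) U μ f)
  have hsym : ∀ x μ, τ (covD (torusT P i) U μ (fun z => (f z)ᴴ) x * covD (torusT P i) U μ g x)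
      = τ (covD (torusT P i) U μ (fun z => (g z)ᴴ) x * covD (torusT P i) U μ f x) := by
    intro x μ
    rw [← conjTranspose_covD hU, ← conjTranspose_covD hU, hτa, hτa, re_trace_conjTranspose_mul_comm]
  have hL : ∑ x : Site P i, (((divB (torusT P i) U (fun μ => covD (torusT P i) U μ f) x)ᴴ * g x).trace).re
      = ∑ x : Site P i, τ ((g x)ᴴ * divB (torusT P i) U (fun μ => covD (torusT P i) U μ f) x) :=
    Finset.sum_congr rfl fun x _ => by rw [hτa, re_trace_conjTranspose_mul_comm]
  rw [hL, ← h2, ← Finset.sum_congr rfl fun x _ => Finset.sum_congr rfl fun μ _ => hsym x μ, h1]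
  exact Finset.sum_congr rfl fun x _ => hτa _

end Laplace

/-! ## §3 ★★ Zeroth order: the interpolation error paired with a test matrix (the (hK₀) representation) -/

section Representation

variable {U : Fin P.d → Site P i → (Matrix (Fin N) (Fin N) ℂ)ˣ}

omit [NeZero N] in
/-- ★★ **`⟨X, (φ − φ_H)(x)⟩ = Σ_z ⟨Δ_Uw(z), Δ_Uφ(z)⟩`** for a pinned interpolant `φ_H` of `φ|_C`, `Δ_U`-biharmonic off `C`, and ANY pinned `w` with `Δ_U²w = δ_x·X` off `C`
(covariant Green's second identity; the monopole representation behind (hK₀)). [cite: Balaban1984PropagatorsI, (1.21) p.21; Balaban1985RegularSpaces, (1.14) p.78] -/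
theorem re_trace_interp_error_eq (hU : ∀ ν x, (U ν x : Matrix (Fin N) (Fin N) ℂ) ∈ unitary (Matrix (Fin N) (Fin N) ℂ))
    (C : Set (Site P i)) (φ φH : Site P i → Matrix (Fin N) (Fin N) ℂ) (hH : ∀ y ∈ C, φH y = φ y)
    (hEL : ∀ z ∉ C, divB (torusT P i) U (fun μ => covD (torusT P i) U μ
      (fun y => divB (torusT P i) U (fun ν => covD (torusT P i) U ν φH) y)) z = 0)
    (x : Site P i) (X : Matrix (Fin N) (Fin N) ℂ) (w : Site P i → Matrix (Fin N) (Fin N) ℂ) (hw0 : ∀ y ∈ C, w y = 0)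
    (hwsrc : ∀ z ∉ C, divB (torusT P i) U (fun μ => covD (torusT P i) U μ
      (fun y => divB (torusT P i) U (fun ν => covD (torusT P i) U ν w) y)) z = if z = x then X else 0) :
    ((Xᴴ * (φ x - φH x)).trace).re
      = ∑ z : Site P i, (((divB (torusT P i) U (fun μ => covD (torusT P i) U μ w) z)ᴴ
          * divB (torusT P i) U (fun μ => covD (torusT P i) U μ φ) z).trace).re := by
  classical
  set ψ : Site P i → Matrix (Fin N) (Fin N) ℂ := fun z => φ z - φH z with hψ
  have hψC : ∀ y ∈ C, ψ y = 0 := fun y hy => by simp [hψ, hH y hy]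
  -- step 1: `Σ_z ⟨Δ²w, ψ⟩ = ⟨X, ψ x⟩`
  have h1 : ∑ z : Site P i, (((divB (torusT P i) U (fun μ => covD (torusT P i) U μ
        (fun y => divB (torusT P i) U (fun ν => covD (torusT P i) U ν w) y)) z)ᴴ * ψ z).trace).re
      = ((Xᴴ * ψ x).trace).re := by
    have hpt : ∀ z : Site P i, (((divB (torusT P i) U (fun μ => covD (torusT P i) U μ
          (fun y => divB (torusT P i) U (fun ν => covD (torusT P i) U ν w) y)) z)ᴴ * ψ z).trace).re
        = if z = x then ((Xᴴ * ψ z).trace).re else 0 := by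
      intro z
      by_cases hz : z ∈ C
      · rw [hψC z hz, mul_zero, mul_zero, Matrix.trace_zero, Complex.zero_re, ite_self]
      · rw [hwsrc z hz]
        by_cases h : z = x
        · rw [if_pos h, if_pos h]
        · rw [if_neg h, if_neg h, Matrix.conjTranspose_zero, zero_mul, Matrix.trace_zero, Complex.zero_re]
    rw [Finset.sum_congr rfl fun z _ => hpt z, Finset.sum_ite_eq' Finset.univ x, if_pos (Finset.mem_univ _)]
  -- step 2: move both Laplacians from `w` to `ψ`
  have h2 := sum_re_trace_covLaplace_comm hU (fun y => divB (torusT P i) U (fun ν => covD (torusT P i) U ν w) y) ψ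
  have h3 := sum_re_trace_covLaplace_comm hU w (fun y => divB (torusT P i) U (fun ν => covD (torusT P i) U ν ψ) y)
  -- step 3: `Δ²ψ = Δ²φ` off `C`, and `w = 0` on `C`
  have h4 : ∑ z : Site P i, (((w z)ᴴ * divB (torusT P i) U (fun μ => covD (torusT P i) U μ
        (fun y => divB (torusT P i) U (fun ν => covD (torusT P i) U ν ψ) y)) z).trace).re
      = ∑ z : Site P i, (((w z)ᴴ * divB (torusT P i) U (fun μ => covD (torusT P i) U μ
        (fun y => divB (torusT P i) U (fun ν => covD (torusT P i) U ν φ) y)) z).trace).re := by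
    refine Finset.sum_congr rfl fun z _ => ?_
    by_cases hz : z ∈ C
    · rw [hw0 z hz, Matrix.conjTranspose_zero, zero_mul, zero_mul]
    · have eψ : (fun y => divB (torusT P i) U (fun ν => covD (torusT P i) U ν ψ) y)
          = fun y => divB (torusT P i) U (fun ν => covD (torusT P i) U ν φ) y - divB (torusT P i) U (fun ν => covD (torusT P i) U ν φH) y := by
        funext y; exact covLaplace_sub φ φH y
      rw [eψ, covLaplace_sub, hEL z hz, sub_zero]
  -- step 4: one Laplacian back onto `w`
  have h5 := sum_re_trace_covLaplace_comm hU w (fun y => divB (torusT P i) U (fun ν => covD (torusT P i) U ν φ) y)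
  rw [show φ x - φH x = ψ x from rfl, ← h1, h2, h3, h4, ← h5]

/-! ## §4 ★★★ First order: the covariant gradient of the error paired with a test matrix (the (hK) representation) -/

omit [NeZero N] in
/-- ★★★ **`⟨X, D_U(φ − φ_H)(x,μ)⟩ = Σ_z ⟨Δ_Uw(z), Δ_Uφ(z)⟩`** for ANY pinned `w` whose covariant bi-Laplacian off `C` is the COVARIANT DIPOLE `δ_{x+e_μ}·R(U_μ(x))⁻¹X − δ_x·X`
(`⟨X, R(U)Y⟩ = ⟨R(U⁻¹)X, Y⟩`; then §3's chain). [cite: Balaban1984PropagatorsI, (1.4) p.18, (1.21) p.21; Balaban1985BackgroundPropagators, (3.3) p.390] -/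
theorem re_trace_covD_interp_error_eq (hU : ∀ ν x, (U ν x : Matrix (Fin N) (Fin N) ℂ) ∈ unitary (Matrix (Fin N) (Fin N) ℂ))
    (C : Set (Site P i)) (φ φH : Site P i → Matrix (Fin N) (Fin N) ℂ) (hH : ∀ y ∈ C, φH y = φ y)
    (hEL : ∀ z ∉ C, divB (torusT P i) U (fun μ => covD (torusT P i) U μ
      (fun y => divB (torusT P i) U (fun ν => covD (torusT P i) U ν φH) y)) z = 0)
    (μ : Fin P.d) (x : Site P i) (X : Matrix (Fin N) (Fin N) ℂ) (w : Site P i → Matrix (Fin N) (Fin N) ℂ) (hw0 : ∀ y ∈ C, w y = 0)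
    (hwsrc : ∀ z ∉ C, divB (torusT P i) U (fun κ => covD (torusT P i) U κ
      (fun y => divB (torusT P i) U (fun ν => covD (torusT P i) U ν w) y)) z
        = (if z = torusT P i μ x then R (U μ x)⁻¹ X else 0) - (if z = x then X else 0)) :
    ((Xᴴ * covD (torusT P i) U μ (fun y => φ y - φH y) x).trace).re
      = ∑ z : Site P i, (((divB (torusT P i) U (fun κ => covD (torusT P i) U κ w) z)ᴴ
          * divB (torusT P i) U (fun κ => covD (torusT P i) U κ φ) z).trace).re := by
  classical
  set ψ : Site P i → Matrix (Fin N) (Fin N) ℂ := fun z => φ z - φH z with hψ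
  have hψC : ∀ y ∈ C, ψ y = 0 := fun y hy => by simp [hψ, hH y hy]
  -- step 0: `⟨X, D_Uψ(x,μ)⟩ = ⟨R(U)⁻¹X, ψ(x+e_μ)⟩ − ⟨X, ψ x⟩`
  have h0 : ((Xᴴ * covD (torusT P i) U μ ψ x).trace).re
      = (((R (U μ x)⁻¹ X)ᴴ * ψ (torusT P i μ x)).trace).re - ((Xᴴ * ψ x).trace).re := by
    rw [covD, mul_sub, Matrix.trace_sub, Complex.sub_re, re_trace_conjTranspose_mul_R (hU μ x)]
  -- step 1: `Σ_z ⟨Δ²w, ψ⟩ = ⟨R(U)⁻¹X, ψ(x+e_μ)⟩ − ⟨X, ψ x⟩`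
  have h1 : ∑ z : Site P i, (((divB (torusT P i) U (fun κ => covD (torusT P i) U κ
        (fun y => divB (torusT P i) U (fun ν => covD (torusT P i) U ν w) y)) z)ᴴ * ψ z).trace).re
      = (((R (U μ x)⁻¹ X)ᴴ * ψ (torusT P i μ x)).trace).re - ((Xᴴ * ψ x).trace).re := by
    have hpt : ∀ z : Site P i, (((divB (torusT P i) U (fun κ => covD (torusT P i) U κ
          (fun y => divB (torusT P i) U (fun ν => covD (torusT P i) U ν w) y)) z)ᴴ * ψ z).trace).re
        = (if z = torusT P i μ x then (((R (U μ x)⁻¹ X)ᴴ * ψ z).trace).re else 0) - (if z = x then ((Xᴴ * ψ z).trace).re else 0) := by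
      intro z
      by_cases hz : z ∈ C
      · rw [hψC z hz, mul_zero, mul_zero, mul_zero, Matrix.trace_zero, Complex.zero_re, ite_self, ite_self, sub_zero]
      · rw [hwsrc z hz, Matrix.conjTranspose_sub, sub_mul, Matrix.trace_sub, Complex.sub_re]
        have hA : (((if z = torusT P i μ x then R (U μ x)⁻¹ X else 0)ᴴ * ψ z).trace).re
            = if z = torusT P i μ x then (((R (U μ x)⁻¹ X)ᴴ * ψ z).trace).re else 0 := by
          by_cases h : z = torusT P i μ x
          · rw [if_pos h, if_pos h]
          · rw [if_neg h, if_neg h, Matrix.conjTranspose_zero, zero_mul, Matrix.trace_zero, Complex.zero_re]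
        have hB : (((if z = x then X else 0)ᴴ * ψ z).trace).re = if z = x then ((Xᴴ * ψ z).trace).re else 0 := by
          by_cases h : z = x
          · rw [if_pos h, if_pos h]
          · rw [if_neg h, if_neg h, Matrix.conjTranspose_zero, zero_mul, Matrix.trace_zero, Complex.zero_re]
        rw [hA, hB]
    rw [Finset.sum_congr rfl fun z _ => hpt z, Finset.sum_sub_distrib, Finset.sum_ite_eq' Finset.univ (torusT P i μ x),
      Finset.sum_ite_eq' Finset.univ x, if_pos (Finset.mem_univ _), if_pos (Finset.mem_univ _)]
  have h2 := sum_re_trace_covLaplace_comm hU (fun y => divB (torusT P i) U (fun ν => covD (torusT P i) U ν w) y) ψ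
  have h3 := sum_re_trace_covLaplace_comm hU w (fun y => divB (torusT P i) U (fun ν => covD (torusT P i) U ν ψ) y)
  have h4 : ∑ z : Site P i, (((w z)ᴴ * divB (torusT P i) U (fun κ => covD (torusT P i) U κ
        (fun y => divB (torusT P i) U (fun ν => covD (torusT P i) U ν ψ) y)) z).trace).re
      = ∑ z : Site P i, (((w z)ᴴ * divB (torusT P i) U (fun κ => covD (torusT P i) U κ
        (fun y => divB (torusT P i) U (fun ν => covD (torusT P i) U ν φ) y)) z).trace).re := by
    refine Finset.sum_congr rfl fun z _ => ?_
    by_cases hz : z ∈ C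
    · rw [hw0 z hz, Matrix.conjTranspose_zero, zero_mul, zero_mul]
    · have eψ : (fun y => divB (torusT P i) U (fun ν => covD (torusT P i) U ν ψ) y)
          = fun y => divB (torusT P i) U (fun ν => covD (torusT P i) U ν φ) y - divB (torusT P i) U (fun ν => covD (torusT P i) U ν φH) y := by
        funext y; exact covLaplace_sub φ φH y
      rw [eψ, covLaplace_sub, hEL z hz, sub_zero]
  have h5 := sum_re_trace_covLaplace_comm hU w (fun y => divB (torusT P i) U (fun ν => covD (torusT P i) U ν φ) y)
  rw [h0, ← h1, h2, h3, h4, ← h5]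

/-! ## §5 ★★★ The covariant (hK₀)∕(hK) rows as `ℓ¹`-of-HS kernel bounds -/

omit [NeZero N] in
/-- ★★★ **THE COVARIANT `hInterp` ROW FROM THE KERNEL BOUND ALONE**: if `√hs(Δ_Uφ(z)) ≤ s₁` everywhere and for every test matrix `X` some pinned `w` with the covariant-dipole
source at the bond `(x, μ)` has `Σ_z √hs(Δ_Uw(z)) ≤ κ·√hs(X)` (`κ ≥ 0`), then `√hs(D_U(φ − φ_H)(x,μ)) ≤ κ·s₁` — P-cov1's displayed `hInterp` at the curved background with
`c_I·ℓ·(s₁′ℓ⁻²) := κ·s₁`, up to the fixed HS↔operator factors. [cite: Balaban1985RegularSpaces, (1.36) p.82; Balaban1983RegularityDecay, (2.27) p.580] -/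
theorem sqrt_hs_covD_interp_error_le (hU : ∀ ν x, (U ν x : Matrix (Fin N) (Fin N) ℂ) ∈ unitary (Matrix (Fin N) (Fin N) ℂ))
    (C : Set (Site P i)) (φ φH : Site P i → Matrix (Fin N) (Fin N) ℂ) (hH : ∀ y ∈ C, φH y = φ y)
    (hEL : ∀ z ∉ C, divB (torusT P i) U (fun μ => covD (torusT P i) U μ
      (fun y => divB (torusT P i) U (fun ν => covD (torusT P i) U ν φH) y)) z = 0)
    {s₁ : ℝ} (hs₁ : ∀ z, Real.sqrt (∑ j : Fin N, ∑ k : Fin N, ‖(divB (torusT P i) U (fun κ => covD (torusT P i) U κ φ) z) j k‖ ^ 2) ≤ s₁)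
    (μ : Fin P.d) (x : Site P i) {κ : ℝ} (hκ : 0 ≤ κ)
    (hker : ∀ X : Matrix (Fin N) (Fin N) ℂ, ∃ w : Site P i → Matrix (Fin N) (Fin N) ℂ, (∀ y ∈ C, w y = 0) ∧
      (∀ z ∉ C, divB (torusT P i) U (fun κ' => covD (torusT P i) U κ'
        (fun y => divB (torusT P i) U (fun ν => covD (torusT P i) U ν w) y)) z
          = (if z = torusT P i μ x then R (U μ x)⁻¹ X else 0) - (if z = x then X else 0)) ∧
      ∑ z : Site P i, Real.sqrt (∑ j : Fin N, ∑ k : Fin N, ‖(divB (torusT P i) U (fun κ' => covD (torusT P i) U κ' w) z) j k‖ ^ 2)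
        ≤ κ * Real.sqrt (∑ j : Fin N, ∑ k : Fin N, ‖X j k‖ ^ 2)) :
    Real.sqrt (∑ j : Fin N, ∑ k : Fin N, ‖(covD (torusT P i) U μ (fun y => φ y - φH y) x) j k‖ ^ 2) ≤ κ * s₁ := by
  set Y := covD (torusT P i) U μ (fun y => φ y - φH y) x with hY
  obtain ⟨w, hw0, hwsrc, hwker⟩ := hker Y
  have hs0 : 0 ≤ s₁ := (Real.sqrt_nonneg _).trans (hs₁ x)
  have hrep := re_trace_covD_interp_error_eq hU C φ φH hH hEL μ x Y w hw0 hwsrc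
  rw [← hY, re_trace_conjTranspose_mul_self] at hrep
  -- `hs Y ≤ κ·√hs(Y)·s₁`
  have hle : ∑ j : Fin N, ∑ k : Fin N, ‖Y j k‖ ^ 2 ≤ κ * Real.sqrt (∑ j : Fin N, ∑ k : Fin N, ‖Y j k‖ ^ 2) * s₁ := by
    calc ∑ j : Fin N, ∑ k : Fin N, ‖Y j k‖ ^ 2
        = ∑ z : Site P i, (((divB (torusT P i) U (fun κ' => covD (torusT P i) U κ' w) z)ᴴ
            * divB (torusT P i) U (fun κ' => covD (torusT P i) U κ' φ) z).trace).re := hrep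
      _ ≤ ∑ z : Site P i, Real.sqrt (∑ j : Fin N, ∑ k : Fin N, ‖(divB (torusT P i) U (fun κ' => covD (torusT P i) U κ' w) z) j k‖ ^ 2) * s₁ := by
          refine Finset.sum_le_sum fun z _ => ?_
          refine (le_abs_self _).trans ((abs_re_trace_le_sqrt_mul_sqrt _ _).trans ?_)
          exact mul_le_mul_of_nonneg_left (hs₁ z) (Real.sqrt_nonneg _)
      _ = (∑ z : Site P i, Real.sqrt (∑ j : Fin N, ∑ k : Fin N, ‖(divB (torusT P i) U (fun κ' => covD (torusT P i) U κ' w) z) j k‖ ^ 2)) * s₁ := by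
          rw [Finset.sum_mul]
      _ ≤ κ * Real.sqrt (∑ j : Fin N, ∑ k : Fin N, ‖Y j k‖ ^ 2) * s₁ := mul_le_mul_of_nonneg_right hwker hs0
  set r := Real.sqrt (∑ j : Fin N, ∑ k : Fin N, ‖Y j k‖ ^ 2) with hr
  have hr0 : 0 ≤ r := Real.sqrt_nonneg _
  have hrr : r * r = ∑ j : Fin N, ∑ k : Fin N, ‖Y j k‖ ^ 2 := Real.mul_self_sqrt (Finset.sum_nonneg fun _ _ => Finset.sum_nonneg fun _ _ => sq_nonneg _)
  rcases hr0.eq_or_lt with hr1 | hr1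
  · rw [← hr1]; positivity
  · rw [← hrr] at hle
    nlinarith [hle, hr1]

omit [NeZero N] in
/-- ★★ **THE COVARIANT `hInterp₀` ROW** (zeroth order): under the monopole kernel bound `Σ_z √hs(Δ_Uw_{x,X}(z)) ≤ κ₀·√hs(X)`, `√hs((φ − φ_H)(x)) ≤ κ₀·s₁`.
[cite: Balaban1985RegularSpaces, (1.36) p.82] -/
theorem sqrt_hs_interp_error_le (hU : ∀ ν x, (U ν x : Matrix (Fin N) (Fin N) ℂ) ∈ unitary (Matrix (Fin N) (Fin N) ℂ))
    (C : Set (Site P i)) (φ φH : Site P i → Matrix (Fin N) (Fin N) ℂ) (hH : ∀ y ∈ C, φH y = φ y)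
    (hEL : ∀ z ∉ C, divB (torusT P i) U (fun μ => covD (torusT P i) U μ
      (fun y => divB (torusT P i) U (fun ν => covD (torusT P i) U ν φH) y)) z = 0)
    {s₁ : ℝ} (hs₁ : ∀ z, Real.sqrt (∑ j : Fin N, ∑ k : Fin N, ‖(divB (torusT P i) U (fun κ => covD (torusT P i) U κ φ) z) j k‖ ^ 2) ≤ s₁)
    (x : Site P i) {κ₀ : ℝ} (hκ : 0 ≤ κ₀)
    (hker : ∀ X : Matrix (Fin N) (Fin N) ℂ, ∃ w : Site P i → Matrix (Fin N) (Fin N) ℂ, (∀ y ∈ C, w y = 0) ∧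
      (∀ z ∉ C, divB (torusT P i) U (fun κ' => covD (torusT P i) U κ'
        (fun y => divB (torusT P i) U (fun ν => covD (torusT P i) U ν w) y)) z = if z = x then X else 0) ∧
      ∑ z : Site P i, Real.sqrt (∑ j : Fin N, ∑ k : Fin N, ‖(divB (torusT P i) U (fun κ' => covD (torusT P i) U κ' w) z) j k‖ ^ 2)
        ≤ κ₀ * Real.sqrt (∑ j : Fin N, ∑ k : Fin N, ‖X j k‖ ^ 2)) :
    Real.sqrt (∑ j : Fin N, ∑ k : Fin N, ‖(φ x - φH x) j k‖ ^ 2) ≤ κ₀ * s₁ := by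
  set Y := φ x - φH x with hY
  obtain ⟨w, hw0, hwsrc, hwker⟩ := hker Y
  have hs0 : 0 ≤ s₁ := (Real.sqrt_nonneg _).trans (hs₁ x)
  have hrep := re_trace_interp_error_eq hU C φ φH hH hEL x Y w hw0 hwsrc
  rw [← hY, re_trace_conjTranspose_mul_self] at hrep
  have hle : ∑ j : Fin N, ∑ k : Fin N, ‖Y j k‖ ^ 2 ≤ κ₀ * Real.sqrt (∑ j : Fin N, ∑ k : Fin N, ‖Y j k‖ ^ 2) * s₁ := by
    calc ∑ j : Fin N, ∑ k : Fin N, ‖Y j k‖ ^ 2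
        = ∑ z : Site P i, (((divB (torusT P i) U (fun κ' => covD (torusT P i) U κ' w) z)ᴴ
            * divB (torusT P i) U (fun κ' => covD (torusT P i) U κ' φ) z).trace).re := hrep
      _ ≤ ∑ z : Site P i, Real.sqrt (∑ j : Fin N, ∑ k : Fin N, ‖(divB (torusT P i) U (fun κ' => covD (torusT P i) U κ' w) z) j k‖ ^ 2) * s₁ := by
          refine Finset.sum_le_sum fun z _ => ?_
          refine (le_abs_self _).trans ((abs_re_trace_le_sqrt_mul_sqrt _ _).trans ?_)
          exact mul_le_mul_of_nonneg_left (hs₁ z) (Real.sqrt_nonneg _)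
      _ = (∑ z : Site P i, Real.sqrt (∑ j : Fin N, ∑ k : Fin N, ‖(divB (torusT P i) U (fun κ' => covD (torusT P i) U κ' w) z) j k‖ ^ 2)) * s₁ := by
          rw [Finset.sum_mul]
      _ ≤ κ₀ * Real.sqrt (∑ j : Fin N, ∑ k : Fin N, ‖Y j k‖ ^ 2) * s₁ := mul_le_mul_of_nonneg_right hwker hs0
  set r := Real.sqrt (∑ j : Fin N, ∑ k : Fin N, ‖Y j k‖ ^ 2) with hr
  have hr0 : 0 ≤ r := Real.sqrt_nonneg _
  have hrr : r * r = ∑ j : Fin N, ∑ k : Fin N, ‖Y j k‖ ^ 2 := Real.mul_self_sqrt (Finset.sum_nonneg fun _ _ => Finset.sum_nonneg fun _ _ => sq_nonneg _)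
  rcases hr0.eq_or_lt with hr1 | hr1
  · rw [← hr1]; positivity
  · rw [← hrr] at hle
    nlinarith [hle, hr1]

end Representation

end Summit.QuantumFields.YangMills.Theorems.Prop7CovInterpKernelDual

end
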